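import Mathlib.Combinatorics.Matroid.Rank.ENat
import Mathlib.Tactic.Ring

/-!
# PercRepro — S2: THE NULLITY-PAYMENT INEQUALITY FOR COINDEPENDENT SETS (p7, gen 9; generic, for S1 / S2 / S3)

The sets counted on the `U`-side of `C025` at level `q` are the `B ⊆ E` of rank `q` whose complement spans
(`M.eRk (M.E \ B) = M.eRank`, i.e. `B` is coindependent). Such a `B` must PAY the nullity of every subset `W ⊆ E`:

  `ρ(E) + |W \ B| ≤ ρ(W) + |E \ B|`,   equivalently   `|B| + ν(W) ≤ ν(E) + |B ∩ W|`.

*Proof.* `ρ(E) = ρ(E \ B) ≤ ρ(W \ B) + |(E \ B) \ (W \ B)| ≤ ρ(W) + |E \ B| − |W \ B|`. ∎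

On a core of nullity `d` (`|E| = ρ(E) + d`) this reads `|B ∩ W| + d ≥ |B| + ν(W)`: a set `W` carrying nullity
`ν(W)` forces `≥ |B| + ν(W) − d` points of every coindependent `B` into `W`. At `(p, d) = (16, 7)` a rank-`4`
`10`-point core `W` (`ν(W) = 6`) leaves the level-`5` sets of size `5 / 6 / 7` with `≥ 4 / 5 / 6` points in `W`
(`#U ≤ 2,982 + 3,486 + 2,850`), which is why the union bound over small circuits (`σ_m · Σ s_k · C(n − k, 6 − k)`)
overcharges a circuit-rich core by a factor `> 2`. Axioms: standard.
-/

open scoped Matroid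

namespace PercRepro

namespace S2

open Set

variable {α : Type}

/-- **Nullity payment, rank form**: if `E \ B` spans `M` then for every `W ⊆ E`,
`ρ(E) + |W \ B| ≤ ρ(W) + |E \ B|` (in `ℕ∞`). -/
theorem eRank_add_encard_diff_le_of_spanning_compl (M : Matroid α) {B W : Set α} (hW : W ⊆ M.E)
    (hB : M.eRk (M.E \ B) = M.eRank) :
    M.eRank + (W \ B).encard ≤ M.eRk W + (M.E \ B).encard := by
  have hsub : W \ B ⊆ M.E \ B := sdiff_subset_sdiff_left hW
  have hsplit : M.E \ B = (W \ B) ∪ ((M.E \ B) \ (W \ B)) := (union_sdiff_cancel hsub).symm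
  calc M.eRank + (W \ B).encard = M.eRk ((W \ B) ∪ ((M.E \ B) \ (W \ B))) + (W \ B).encard := by
        rw [← hsplit, hB]
    _ ≤ (M.eRk (W \ B) + ((M.E \ B) \ (W \ B)).encard) + (W \ B).encard := by
        gcongr
        exact M.eRk_union_le_eRk_add_encard _ _
    _ ≤ (M.eRk W + ((M.E \ B) \ (W \ B)).encard) + (W \ B).encard := by
        gcongr
        exact M.eRk_mono sdiff_subset
    _ = M.eRk W + (M.E \ B).encard := by
        rw [add_assoc, encard_sdiff_add_encard_of_subset hsub]

/-- **Nullity payment, counting form**: if `B ⊆ E` and `E \ B` spans `M` then for every `W ⊆ E`,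
`|B| + |W| + ρ(E) ≤ |E| + ρ(W) + |W ∩ B|` — i.e. `|B| + ν(W) ≤ ν(E) + |B ∩ W|` without subtraction. -/
theorem encard_add_encard_add_eRank_le_of_spanning_compl (M : Matroid α) {B W : Set α} (hBE : B ⊆ M.E)
    (hW : W ⊆ M.E) (hB : M.eRk (M.E \ B) = M.eRank) :
    B.encard + W.encard + M.eRank ≤ M.E.encard + M.eRk W + (W ∩ B).encard := by
  have h := eRank_add_encard_diff_le_of_spanning_compl M hW hB
  have hWsplit : (W \ B).encard + (W ∩ B).encard = W.encard := by
    rw [← encard_union_eq disjoint_sdiff_inter, sdiff_union_inter]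
  have hEsplit : (M.E \ B).encard + B.encard = M.E.encard := encard_sdiff_add_encard_of_subset hBE
  calc B.encard + W.encard + M.eRank
      = (M.eRank + (W \ B).encard) + (W ∩ B).encard + B.encard := by rw [← hWsplit]; ring
    _ ≤ (M.eRk W + (M.E \ B).encard) + (W ∩ B).encard + B.encard := by gcongr
    _ = M.E.encard + M.eRk W + (W ∩ B).encard := by rw [← hEsplit]; ring

/-- **Nullity payment on a core of nullity `d`**: with `|E| = ρ(E) + d` and `|W| = ρ(W) + k` (`W ⊆ E` of
nullity `k`), every coindependent `B ⊆ E` has `|B| + k ≤ d + |B ∩ W|`. -/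
theorem encard_add_le_of_spanning_compl_of_nullity (M : Matroid α) {B W : Set α} {d k : ℕ} (hBE : B ⊆ M.E)
    (hW : W ⊆ M.E) (hB : M.eRk (M.E \ B) = M.eRank) (hd : M.E.encard = M.eRank + d)
    (hk : W.encard = M.eRk W + k) (hfin : M.eRk W ≠ ⊤) (hR : M.eRank ≠ ⊤) :
    B.encard + k ≤ d + (W ∩ B).encard := by
  have h := encard_add_encard_add_eRank_le_of_spanning_compl M hBE hW hB
  rw [hd, hk] at h
  -- `B + (ρW + k) + ρE ≤ (ρE + d) + ρW + (W ∩ B)`: cancel the finite `ρW + ρE`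
  have h' : (B.encard + k) + (M.eRk W + M.eRank) ≤ (d + (W ∩ B).encard) + (M.eRk W + M.eRank) := by
    calc (B.encard + k) + (M.eRk W + M.eRank) = B.encard + (M.eRk W + k) + M.eRank := by ring
      _ ≤ M.eRank + d + M.eRk W + (W ∩ B).encard := h
      _ = (d + (W ∩ B).encard) + (M.eRk W + M.eRank) := by ring
  exact (WithTop.add_le_add_iff_right (WithTop.add_ne_top.2 ⟨hfin, hR⟩)).1 h'

end S2

end PercRepro
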